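import Summits.QuantumFields.BalabanUV.Beta.GAN24.SlotDefectWindowBound

/-!
# `BalabanUV.Beta.GAN24.SlotDefectWindowLegs` — binder row G-an2-4 ∕ (CONV-C), CT-W, route of record «WC-TL»; ι-WIN PART 4 (journal INTENT [LEAF02-G53-ONLINE], X1 INFO I1):
# **THE LEG-TOUCHING TERMS OF T-DL, TABLE LEVEL — the two single-leg defects `D_{L₁}`, `D_{L₂}` and the five `|S| = 2` nests with a leg
# (`D_{2,L₁}`, `D_{2,L₂}`, `D_{1,L₁}`, `D_{1,L₂}`, `D_{L₁,L₂}`) are bounded entrywise by `|S|`-fold window sums of the `S`-fold mixed divergences; multiplier rows vanish**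

NOT IN PRINT; OUR BOOKKEEPING (G-an2-4 crux team (2), leaf prover `b2b-balaban-gan24-formalise-leaf-02`, gen 53).  [folklore] finite-window bookkeeping, PART 1's one-form core
`abs_coProjBmAt_sub_self_le` iterated; the commutations «divergence in one variable ∘ (Πᵀ_bm − 1) in another = (Πᵀ_bm − 1) ∘ divergence» are finite-sum identities
(`coProjBmAt_finset_sum_sub`).  Generic `d + 1`, in-block root, `1 ≤ N`; NO decay hypothesis; 0 `def`, 0 cited facts, 0 `def … : Prop`, 0 sorry.
The leg divergences are NOT slaved today ((Q-L) OPEN, RULING R-gan24p1-g24-2; candidate «QL-LL», W14 l.39455): these lemmas are the OPERATOR half for the leg terms of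
row (Q-D) under either exit.  HONEST FRAMING (cell contract, verbatim): «discharging `BetaPertH` makes Bałaban's UV stability UNCONDITIONAL — a real constructive-QFT
result; it is NOT the continuum limit and NOT the Clay problem.»  HONEST DEPENDENCY (verbatim): «continuum YM on T⁴ ⇐ BetaPertH ∧ nine spine estimates (0/9 proved);
BetaPertH ⇐ (D1) ∧ (D4) ∧ CAP+tail; G-an2-4 gates asym, D1 and NE2/3/4.»

## Letters (T-DL's, leaf-06 `TableDressingExpansion.tableDress_sub_self_eq_fifteen` :179): `P₂ Y := κ u ↦ coProjBmAtK ρ N (Y κ u)`, `P₁ Y := κ u κ′ u′ ↦ coProjBmAtK ρ N (κ₁ u₁ ↦ Y κ₁ u₁ κ′ u′) κ u`,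
## `L₁ Y := κ u κ′ u′ ↦ legCo₁BmAt ρ N (Y κ u κ′ u′)`, `L₂ Y := κ u κ′ u′ ↦ legCo₂BmAt ρ N (Y κ u κ′ u′)`; leg divergences `∂₁V p z a′ b := Σ_β (V p z (inl β) b − V (p − e_β) z (inl β) b)`,
## `∂₂V x p a := Σ_β (V x p a (inl β) − V x (p − e_β) a (inl β))` (written out, no def).
* §1 single legs, table level: `abs_legDefect₁_inl_le`, `legDefect₁_inr`, `abs_legDefect₂_inl_le`, `legDefect₂_inr`.
* §2 commutations: `legDiv₁_coProj_snd_sub_self` (`∂₁ (P₂ Y − Y) = (Πᵀ_bm − 1)` in slot 2 of `∂₁ Y`), `legDiv₁_coProj_fst_sub_self`, `legDiv₂_coProj_snd_sub_self`,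
  `legDiv₂_coProj_fst_sub_self`, `legDiv₂_legCo₁_sub_self_inl` (`∂₂ (L₁ Y − Y)` on field rows = `(Πᵀ_bm − 1)` in leg 1 of `∂₂ Y`), `legDiv₂_legCo₁_sub_self_inr` (`= 0`).
* §3 the five `|S| = 2` nests with a leg: `abs_defect_snd_leg₁_le`, `abs_defect_fst_leg₁_le`, `abs_defect_snd_leg₂_le`, `abs_defect_fst_leg₂_le`, `abs_defect_leg₁_leg₂_le`
  (field rows; `(2(d+1)N)²` × double window of the mixed double divergence) and the vanishing of the multiplier rows.
-/

noncomputable section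

open Finset
open scoped BigOperators
open Literature.MathematicalPhysics.QuantumFieldTheory
open Literature.MathematicalPhysics.QuantumFieldTheory.Balaban1983to89
open Literature.MathematicalPhysics.QuantumFieldTheory.Balaban1983to89.Beta
open B12Sec2to5 (l1 l1_nonneg)
open ExpKernelCalculus (MKer Site)
open AffineAveraging (Form0 Form1 box toSite unitVec)
open OneStepResolventKernel (Fib)
open KernelWard (divV)
open Summit.QuantumFields.BalabanUV.Beta.AxialDressingRooted (cube coProjBmAt coProjBmAtK coProjBmAtK_eval legCo₁BmAt legCo₂BmAt legCo₁BmAt_inl legCo₂BmAt_inl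
  legCo₁BmAt_inr legCo₂BmAt_inr)
open Summit.QuantumFields.BalabanUV.Beta.GAN24.BiStencilZeroMode (Tab)
open Summit.QuantumFields.BalabanUV.Beta.GAN24.SlotDefectWindowBound (abs_coProjBmAt_sub_self_le abs_coProjBmAt_sub_self_le_divV coProjBmAt_finset_sum_sub divV_apply
  two_mul_nonneg abs_legCo₁_sub_self_inl_le abs_legCo₂_sub_self_inl_le)

namespace Summit.QuantumFields.BalabanUV.Beta.GAN24.SlotDefectWindowLegs

variable {d : ℕ}

/-! ## §1 The single-leg defects at table level -/

section Single

variable {N : ℕ} {r : Fin (d + 1) → ℕ}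

/-- NOT IN PRINT; OUR BOOKKEEPING.  **`D_{L₁}` ON FIELD ROWS IS BOUNDED BY THE WINDOW SUM OF THE FIRST-LEG DIVERGENCE** (in-block root, `1 ≤ N`, ANY table):
`|(L₁ Y − Y) κ u κ′ u′ x z (inl α) b| ≤ 2(d+1)N · Σ_{v ∈ cube} |Σ_β (Y κ u κ′ u′ (x+v) z (inl β) b − Y κ u κ′ u′ (x+v−e_β) z (inl β) b)|`. -/
theorem abs_legDefect₁_inl_le (hN : 1 ≤ N) (hr : r ∈ box (d + 1) N) (Y : Tab d) (κ : Fin (d + 1)) (u : Fin (d + 1) → ℤ) (κ' : Fin (d + 1))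
    (u' x z : Fin (d + 1) → ℤ) (α : Fin (d + 1)) (b : Fib d) :
    |((fun κ u κ' u' => legCo₁BmAt (toSite r) N (Y κ u κ' u')) - Y) κ u κ' u' x z (Sum.inl α) b|
      ≤ 2 * ((d : ℝ) + 1) * N * ∑ v ∈ cube (d + 1) N,
          |∑ β : Fin (d + 1), (Y κ u κ' u' (x + v) z (Sum.inl β) b - Y κ u κ' u' (x + v - unitVec β) z (Sum.inl β) b)| :=
  abs_legCo₁_sub_self_inl_le hN hr (Y κ u κ' u') x z α b

/-- [folklore] `D_{L₁}` vanishes on multiplier rows. -/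
theorem legDefect₁_inr (ρ : Fin (d + 1) → ℤ) (N : ℕ) (Y : Tab d) (κ : Fin (d + 1)) (u : Fin (d + 1) → ℤ) (κ' : Fin (d + 1)) (u' x z : Fin (d + 1) → ℤ)
    (m : Fin (d + 1)) (b : Fib d) :
    ((fun κ u κ' u' => legCo₁BmAt ρ N (Y κ u κ' u')) - Y) κ u κ' u' x z (Sum.inr m) b = 0 := by
  show legCo₁BmAt ρ N (Y κ u κ' u') x z (Sum.inr m) b - Y κ u κ' u' x z (Sum.inr m) b = 0
  rw [legCo₁BmAt_inr, sub_self]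

/-- NOT IN PRINT; OUR BOOKKEEPING.  **`D_{L₂}` ON FIELD COLUMNS IS BOUNDED BY THE WINDOW SUM OF THE SECOND-LEG DIVERGENCE**:
`|(L₂ Y − Y) κ u κ′ u′ x z a (inl β₀)| ≤ 2(d+1)N · Σ_{v ∈ cube} |Σ_β (Y κ u κ′ u′ x (z+v) a (inl β) − Y κ u κ′ u′ x (z+v−e_β) a (inl β))|`. -/
theorem abs_legDefect₂_inl_le (hN : 1 ≤ N) (hr : r ∈ box (d + 1) N) (Y : Tab d) (κ : Fin (d + 1)) (u : Fin (d + 1) → ℤ) (κ' : Fin (d + 1))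
    (u' x z : Fin (d + 1) → ℤ) (a : Fib d) (β₀ : Fin (d + 1)) :
    |((fun κ u κ' u' => legCo₂BmAt (toSite r) N (Y κ u κ' u')) - Y) κ u κ' u' x z a (Sum.inl β₀)|
      ≤ 2 * ((d : ℝ) + 1) * N * ∑ v ∈ cube (d + 1) N,
          |∑ β : Fin (d + 1), (Y κ u κ' u' x (z + v) a (Sum.inl β) - Y κ u κ' u' x (z + v - unitVec β) a (Sum.inl β))| :=
  abs_legCo₂_sub_self_inl_le hN hr (Y κ u κ' u') x z a β₀

/-- [folklore] `D_{L₂}` vanishes on multiplier columns. -/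
theorem legDefect₂_inr (ρ : Fin (d + 1) → ℤ) (N : ℕ) (Y : Tab d) (κ : Fin (d + 1)) (u : Fin (d + 1) → ℤ) (κ' : Fin (d + 1)) (u' x z : Fin (d + 1) → ℤ)
    (a : Fib d) (m : Fin (d + 1)) :
    ((fun κ u κ' u' => legCo₂BmAt ρ N (Y κ u κ' u')) - Y) κ u κ' u' x z a (Sum.inr m) = 0 := by
  show legCo₂BmAt ρ N (Y κ u κ' u') x z a (Sum.inr m) - Y κ u κ' u' x z a (Sum.inr m) = 0
  rw [legCo₂BmAt_inr, sub_self]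

end Single

/-! ## §2 Commutations: a divergence in one variable passes through `Πᵀ_bm − 1` in another -/

section Commute

variable (ρ : Fin (d + 1) → ℤ) (N : ℕ)

/-- [folklore] **`∂₁ ∘ (P₂ − 1) = (Πᵀ_bm − 1)_{slot 2} ∘ ∂₁`**: the first-leg divergence of the second-slot defect is the window defect (in the second slot) of the first-leg
divergence: `∂₁ (P₂ Y − Y) κ u κ′ u′ (p; z, b) = coProjBmAt ρ N G κ′ u′ − G κ′ u′`, `G κ₂ u₂ := Σ_β (Y κ u κ₂ u₂ p z (inl β) b − Y κ u κ₂ u₂ (p − e_β) z (inl β) b)`. -/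
theorem legDiv₁_coProj_snd_sub_self (Y : Tab d) (κ : Fin (d + 1)) (u : Fin (d + 1) → ℤ) (κ' : Fin (d + 1)) (u' p z : Fin (d + 1) → ℤ) (b : Fib d) :
    ∑ β : Fin (d + 1), (((fun κ u => coProjBmAtK ρ N (Y κ u)) - Y) κ u κ' u' p z (Sum.inl β) b
        - ((fun κ u => coProjBmAtK ρ N (Y κ u)) - Y) κ u κ' u' (p - unitVec β) z (Sum.inl β) b)
      = coProjBmAt ρ N (fun κ₂ u₂ => ∑ β : Fin (d + 1), (Y κ u κ₂ u₂ p z (Sum.inl β) b - Y κ u κ₂ u₂ (p - unitVec β) z (Sum.inl β) b)) κ' u'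
        - ∑ β : Fin (d + 1), (Y κ u κ' u' p z (Sum.inl β) b - Y κ u κ' u' (p - unitVec β) z (Sum.inl β) b) := by
  rw [coProjBmAt_finset_sum_sub, ← Finset.sum_sub_distrib]
  refine Finset.sum_congr rfl fun β _ => ?_
  simp only [Pi.sub_apply, coProjBmAtK_eval]
  ring

/-- [folklore] **`∂₁ ∘ (P₁ − 1) = (Πᵀ_bm − 1)_{slot 1} ∘ ∂₁`**: `∂₁ (P₁ Y − Y) κ u κ′ u′ (p; z, b) = coProjBmAt ρ N G κ u − G κ u`,
`G κ₁ u₁ := Σ_β (Y κ₁ u₁ κ′ u′ p z (inl β) b − Y κ₁ u₁ κ′ u′ (p − e_β) z (inl β) b)`. -/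
theorem legDiv₁_coProj_fst_sub_self (Y : Tab d) (κ : Fin (d + 1)) (u : Fin (d + 1) → ℤ) (κ' : Fin (d + 1)) (u' p z : Fin (d + 1) → ℤ) (b : Fib d) :
    ∑ β : Fin (d + 1), (((fun κ u κ' u' => coProjBmAtK ρ N (fun κ₁ u₁ => Y κ₁ u₁ κ' u') κ u) - Y) κ u κ' u' p z (Sum.inl β) b
        - ((fun κ u κ' u' => coProjBmAtK ρ N (fun κ₁ u₁ => Y κ₁ u₁ κ' u') κ u) - Y) κ u κ' u' (p - unitVec β) z (Sum.inl β) b)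
      = coProjBmAt ρ N (fun κ₁ u₁ => ∑ β : Fin (d + 1), (Y κ₁ u₁ κ' u' p z (Sum.inl β) b - Y κ₁ u₁ κ' u' (p - unitVec β) z (Sum.inl β) b)) κ u
        - ∑ β : Fin (d + 1), (Y κ u κ' u' p z (Sum.inl β) b - Y κ u κ' u' (p - unitVec β) z (Sum.inl β) b) := by
  rw [coProjBmAt_finset_sum_sub, ← Finset.sum_sub_distrib]
  refine Finset.sum_congr rfl fun β _ => ?_
  simp only [Pi.sub_apply, coProjBmAtK_eval]
  ring

/-- [folklore] **`∂₂ ∘ (P₂ − 1) = (Πᵀ_bm − 1)_{slot 2} ∘ ∂₂`**: `∂₂ (P₂ Y − Y) κ u κ′ u′ (x; p; a) = coProjBmAt ρ N G κ′ u′ − G κ′ u′`,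
`G κ₂ u₂ := Σ_β (Y κ u κ₂ u₂ x p a (inl β) − Y κ u κ₂ u₂ x (p − e_β) a (inl β))`. -/
theorem legDiv₂_coProj_snd_sub_self (Y : Tab d) (κ : Fin (d + 1)) (u : Fin (d + 1) → ℤ) (κ' : Fin (d + 1)) (u' x p : Fin (d + 1) → ℤ) (a : Fib d) :
    ∑ β : Fin (d + 1), (((fun κ u => coProjBmAtK ρ N (Y κ u)) - Y) κ u κ' u' x p a (Sum.inl β)
        - ((fun κ u => coProjBmAtK ρ N (Y κ u)) - Y) κ u κ' u' x (p - unitVec β) a (Sum.inl β))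
      = coProjBmAt ρ N (fun κ₂ u₂ => ∑ β : Fin (d + 1), (Y κ u κ₂ u₂ x p a (Sum.inl β) - Y κ u κ₂ u₂ x (p - unitVec β) a (Sum.inl β))) κ' u'
        - ∑ β : Fin (d + 1), (Y κ u κ' u' x p a (Sum.inl β) - Y κ u κ' u' x (p - unitVec β) a (Sum.inl β)) := by
  rw [coProjBmAt_finset_sum_sub, ← Finset.sum_sub_distrib]
  refine Finset.sum_congr rfl fun β _ => ?_
  simp only [Pi.sub_apply, coProjBmAtK_eval]
  ring

/-- [folklore] **`∂₂ ∘ (P₁ − 1) = (Πᵀ_bm − 1)_{slot 1} ∘ ∂₂`**: `∂₂ (P₁ Y − Y) κ u κ′ u′ (x; p; a) = coProjBmAt ρ N G κ u − G κ u`,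
`G κ₁ u₁ := Σ_β (Y κ₁ u₁ κ′ u′ x p a (inl β) − Y κ₁ u₁ κ′ u′ x (p − e_β) a (inl β))`. -/
theorem legDiv₂_coProj_fst_sub_self (Y : Tab d) (κ : Fin (d + 1)) (u : Fin (d + 1) → ℤ) (κ' : Fin (d + 1)) (u' x p : Fin (d + 1) → ℤ) (a : Fib d) :
    ∑ β : Fin (d + 1), (((fun κ u κ' u' => coProjBmAtK ρ N (fun κ₁ u₁ => Y κ₁ u₁ κ' u') κ u) - Y) κ u κ' u' x p a (Sum.inl β)
        - ((fun κ u κ' u' => coProjBmAtK ρ N (fun κ₁ u₁ => Y κ₁ u₁ κ' u') κ u) - Y) κ u κ' u' x (p - unitVec β) a (Sum.inl β))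
      = coProjBmAt ρ N (fun κ₁ u₁ => ∑ β : Fin (d + 1), (Y κ₁ u₁ κ' u' x p a (Sum.inl β) - Y κ₁ u₁ κ' u' x (p - unitVec β) a (Sum.inl β))) κ u
        - ∑ β : Fin (d + 1), (Y κ u κ' u' x p a (Sum.inl β) - Y κ u κ' u' x (p - unitVec β) a (Sum.inl β)) := by
  rw [coProjBmAt_finset_sum_sub, ← Finset.sum_sub_distrib]
  refine Finset.sum_congr rfl fun β _ => ?_
  simp only [Pi.sub_apply, coProjBmAtK_eval]
  ring

/-- [folklore] **`∂₂ ∘ (L₁ − 1) = (Πᵀ_bm − 1)_{leg 1} ∘ ∂₂` ON FIELD ROWS**: `∂₂ (L₁ Y − Y) κ u κ′ u′ (x; p; inl α) = coProjBmAt ρ N G α x − G α x`,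
`G α′ x′ := Σ_β (Y κ u κ′ u′ x′ p (inl α′) (inl β) − Y κ u κ′ u′ x′ (p − e_β) (inl α′) (inl β))`. -/
theorem legDiv₂_legCo₁_sub_self_inl (Y : Tab d) (κ : Fin (d + 1)) (u : Fin (d + 1) → ℤ) (κ' : Fin (d + 1)) (u' x p : Fin (d + 1) → ℤ) (α : Fin (d + 1)) :
    ∑ β : Fin (d + 1), (((fun κ u κ' u' => legCo₁BmAt ρ N (Y κ u κ' u')) - Y) κ u κ' u' x p (Sum.inl α) (Sum.inl β)
        - ((fun κ u κ' u' => legCo₁BmAt ρ N (Y κ u κ' u')) - Y) κ u κ' u' x (p - unitVec β) (Sum.inl α) (Sum.inl β))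
      = coProjBmAt ρ N (fun α' x' => ∑ β : Fin (d + 1), (Y κ u κ' u' x' p (Sum.inl α') (Sum.inl β) - Y κ u κ' u' x' (p - unitVec β) (Sum.inl α') (Sum.inl β))) α x
        - ∑ β : Fin (d + 1), (Y κ u κ' u' x p (Sum.inl α) (Sum.inl β) - Y κ u κ' u' x (p - unitVec β) (Sum.inl α) (Sum.inl β)) := by
  rw [coProjBmAt_finset_sum_sub, ← Finset.sum_sub_distrib]
  refine Finset.sum_congr rfl fun β _ => ?_
  simp only [Pi.sub_apply, legCo₁BmAt_inl]
  ring

/-- [folklore] `∂₂ (L₁ Y − Y)` vanishes on multiplier rows. -/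
theorem legDiv₂_legCo₁_sub_self_inr (Y : Tab d) (κ : Fin (d + 1)) (u : Fin (d + 1) → ℤ) (κ' : Fin (d + 1)) (u' x p : Fin (d + 1) → ℤ) (m : Fin (d + 1)) :
    ∑ β : Fin (d + 1), (((fun κ u κ' u' => legCo₁BmAt ρ N (Y κ u κ' u')) - Y) κ u κ' u' x p (Sum.inr m) (Sum.inl β)
        - ((fun κ u κ' u' => legCo₁BmAt ρ N (Y κ u κ' u')) - Y) κ u κ' u' x (p - unitVec β) (Sum.inr m) (Sum.inl β)) = 0 := by
  refine Finset.sum_eq_zero fun β _ => ?_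
  simp only [Pi.sub_apply, legCo₁BmAt_inr, sub_self]

end Commute

/-! ## §3 The five `|S| = 2` nests with a leg -/

section Nest

variable {N : ℕ} {r : Fin (d + 1) → ℕ}

/-- NOT IN PRINT; OUR BOOKKEEPING.  **`D_{2,L₁} = L₁ (P₂ Y − Y) − (P₂ Y − Y)` ON FIELD ROWS** (in-block root, `1 ≤ N`, ANY table): bounded by `(2(d+1)N)²` times the double
window sum of the mixed divergence `∂₂∂₁ Y` (second slot at `u′ + v′`, first leg at `x + v`). -/
theorem abs_defect_snd_leg₁_le (hN : 1 ≤ N) (hr : r ∈ box (d + 1) N) (Y : Tab d) (κ : Fin (d + 1)) (u : Fin (d + 1) → ℤ) (κ' : Fin (d + 1))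
    (u' x z : Fin (d + 1) → ℤ) (α : Fin (d + 1)) (b : Fib d) :
    |((fun κ u κ' u' => legCo₁BmAt (toSite r) N (((fun κ u => coProjBmAtK (toSite r) N (Y κ u)) - Y) κ u κ' u'))
        - ((fun κ u => coProjBmAtK (toSite r) N (Y κ u)) - Y)) κ u κ' u' x z (Sum.inl α) b|
      ≤ (2 * ((d : ℝ) + 1) * N) ^ 2 * ∑ v ∈ cube (d + 1) N, ∑ v' ∈ cube (d + 1) N,
          |∑ β' : Fin (d + 1), ((∑ β : Fin (d + 1), (Y κ u β' (u' + v') (x + v) z (Sum.inl β) b - Y κ u β' (u' + v') (x + v - unitVec β) z (Sum.inl β) b))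
            - (∑ β : Fin (d + 1), (Y κ u β' (u' + v' - unitVec β') (x + v) z (Sum.inl β) b
                - Y κ u β' (u' + v' - unitVec β') (x + v - unitVec β) z (Sum.inl β) b)))| := by
  set Z : Tab d := (fun κ u => coProjBmAtK (toSite r) N (Y κ u)) - Y with hZ
  have h1 := abs_legDefect₁_inl_le hN hr Z κ u κ' u' x z α b
  have h3 : ∀ v ∈ cube (d + 1) N, |∑ β : Fin (d + 1), (Z κ u κ' u' (x + v) z (Sum.inl β) b - Z κ u κ' u' (x + v - unitVec β) z (Sum.inl β) b)|
      ≤ 2 * ((d : ℝ) + 1) * N * ∑ v' ∈ cube (d + 1) N,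
          |∑ β' : Fin (d + 1), ((∑ β : Fin (d + 1), (Y κ u β' (u' + v') (x + v) z (Sum.inl β) b - Y κ u β' (u' + v') (x + v - unitVec β) z (Sum.inl β) b))
            - (∑ β : Fin (d + 1), (Y κ u β' (u' + v' - unitVec β') (x + v) z (Sum.inl β) b
                - Y κ u β' (u' + v' - unitVec β') (x + v - unitVec β) z (Sum.inl β) b)))| := by
    intro v _
    rw [hZ, legDiv₁_coProj_snd_sub_self]
    exact abs_coProjBmAt_sub_self_le hN hr _ κ' u'
  refine h1.trans ?_
  calc 2 * ((d : ℝ) + 1) * N * ∑ v ∈ cube (d + 1) N, |∑ β : Fin (d + 1), (Z κ u κ' u' (x + v) z (Sum.inl β) b - Z κ u κ' u' (x + v - unitVec β) z (Sum.inl β) b)|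
      ≤ 2 * ((d : ℝ) + 1) * N * ∑ v ∈ cube (d + 1) N, (2 * ((d : ℝ) + 1) * N * ∑ v' ∈ cube (d + 1) N,
          |∑ β' : Fin (d + 1), ((∑ β : Fin (d + 1), (Y κ u β' (u' + v') (x + v) z (Sum.inl β) b - Y κ u β' (u' + v') (x + v - unitVec β) z (Sum.inl β) b))
            - (∑ β : Fin (d + 1), (Y κ u β' (u' + v' - unitVec β') (x + v) z (Sum.inl β) b
                - Y κ u β' (u' + v' - unitVec β') (x + v - unitVec β) z (Sum.inl β) b)))|) :=
        mul_le_mul_of_nonneg_left (Finset.sum_le_sum h3) (two_mul_nonneg d N)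
    _ = _ := by rw [← Finset.mul_sum]; ring

/-- [folklore] `D_{2,L₁}` vanishes on multiplier rows. -/
theorem defect_snd_leg₁_inr (ρ : Fin (d + 1) → ℤ) (N : ℕ) (Y : Tab d) (κ : Fin (d + 1)) (u : Fin (d + 1) → ℤ) (κ' : Fin (d + 1)) (u' x z : Fin (d + 1) → ℤ)
    (m : Fin (d + 1)) (b : Fib d) :
    ((fun κ u κ' u' => legCo₁BmAt ρ N (((fun κ u => coProjBmAtK ρ N (Y κ u)) - Y) κ u κ' u'))
        - ((fun κ u => coProjBmAtK ρ N (Y κ u)) - Y)) κ u κ' u' x z (Sum.inr m) b = 0 :=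
  legDefect₁_inr ρ N _ κ u κ' u' x z m b

/-- NOT IN PRINT; OUR BOOKKEEPING.  **`D_{1,L₁} = L₁ (P₁ Y − Y) − (P₁ Y − Y)` ON FIELD ROWS**: bounded by `(2(d+1)N)²` times the double window sum of `∂₁^{slot}∂₁^{leg} Y`
(first slot at `u + v′`, first leg at `x + v`). -/
theorem abs_defect_fst_leg₁_le (hN : 1 ≤ N) (hr : r ∈ box (d + 1) N) (Y : Tab d) (κ : Fin (d + 1)) (u : Fin (d + 1) → ℤ) (κ' : Fin (d + 1))
    (u' x z : Fin (d + 1) → ℤ) (α : Fin (d + 1)) (b : Fib d) :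
    |((fun κ u κ' u' => legCo₁BmAt (toSite r) N (((fun κ u κ' u' => coProjBmAtK (toSite r) N (fun κ₁ u₁ => Y κ₁ u₁ κ' u') κ u) - Y) κ u κ' u'))
        - ((fun κ u κ' u' => coProjBmAtK (toSite r) N (fun κ₁ u₁ => Y κ₁ u₁ κ' u') κ u) - Y)) κ u κ' u' x z (Sum.inl α) b|
      ≤ (2 * ((d : ℝ) + 1) * N) ^ 2 * ∑ v ∈ cube (d + 1) N, ∑ v' ∈ cube (d + 1) N,
          |∑ β' : Fin (d + 1), ((∑ β : Fin (d + 1), (Y β' (u + v') κ' u' (x + v) z (Sum.inl β) b - Y β' (u + v') κ' u' (x + v - unitVec β) z (Sum.inl β) b))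
            - (∑ β : Fin (d + 1), (Y β' (u + v' - unitVec β') κ' u' (x + v) z (Sum.inl β) b
                - Y β' (u + v' - unitVec β') κ' u' (x + v - unitVec β) z (Sum.inl β) b)))| := by
  set W : Tab d := (fun κ u κ' u' => coProjBmAtK (toSite r) N (fun κ₁ u₁ => Y κ₁ u₁ κ' u') κ u) - Y with hW
  have h1 := abs_legDefect₁_inl_le hN hr W κ u κ' u' x z α b
  have h3 : ∀ v ∈ cube (d + 1) N, |∑ β : Fin (d + 1), (W κ u κ' u' (x + v) z (Sum.inl β) b - W κ u κ' u' (x + v - unitVec β) z (Sum.inl β) b)|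
      ≤ 2 * ((d : ℝ) + 1) * N * ∑ v' ∈ cube (d + 1) N,
          |∑ β' : Fin (d + 1), ((∑ β : Fin (d + 1), (Y β' (u + v') κ' u' (x + v) z (Sum.inl β) b - Y β' (u + v') κ' u' (x + v - unitVec β) z (Sum.inl β) b))
            - (∑ β : Fin (d + 1), (Y β' (u + v' - unitVec β') κ' u' (x + v) z (Sum.inl β) b
                - Y β' (u + v' - unitVec β') κ' u' (x + v - unitVec β) z (Sum.inl β) b)))| := by
    intro v _
    rw [hW, legDiv₁_coProj_fst_sub_self]
    exact abs_coProjBmAt_sub_self_le hN hr _ κ u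
  refine h1.trans ?_
  calc 2 * ((d : ℝ) + 1) * N * ∑ v ∈ cube (d + 1) N, |∑ β : Fin (d + 1), (W κ u κ' u' (x + v) z (Sum.inl β) b - W κ u κ' u' (x + v - unitVec β) z (Sum.inl β) b)|
      ≤ 2 * ((d : ℝ) + 1) * N * ∑ v ∈ cube (d + 1) N, (2 * ((d : ℝ) + 1) * N * ∑ v' ∈ cube (d + 1) N,
          |∑ β' : Fin (d + 1), ((∑ β : Fin (d + 1), (Y β' (u + v') κ' u' (x + v) z (Sum.inl β) b - Y β' (u + v') κ' u' (x + v - unitVec β) z (Sum.inl β) b))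
            - (∑ β : Fin (d + 1), (Y β' (u + v' - unitVec β') κ' u' (x + v) z (Sum.inl β) b
                - Y β' (u + v' - unitVec β') κ' u' (x + v - unitVec β) z (Sum.inl β) b)))|) :=
        mul_le_mul_of_nonneg_left (Finset.sum_le_sum h3) (two_mul_nonneg d N)
    _ = _ := by rw [← Finset.mul_sum]; ring

/-- [folklore] `D_{1,L₁}` vanishes on multiplier rows. -/
theorem defect_fst_leg₁_inr (ρ : Fin (d + 1) → ℤ) (N : ℕ) (Y : Tab d) (κ : Fin (d + 1)) (u : Fin (d + 1) → ℤ) (κ' : Fin (d + 1)) (u' x z : Fin (d + 1) → ℤ)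
    (m : Fin (d + 1)) (b : Fib d) :
    ((fun κ u κ' u' => legCo₁BmAt ρ N (((fun κ u κ' u' => coProjBmAtK ρ N (fun κ₁ u₁ => Y κ₁ u₁ κ' u') κ u) - Y) κ u κ' u'))
        - ((fun κ u κ' u' => coProjBmAtK ρ N (fun κ₁ u₁ => Y κ₁ u₁ κ' u') κ u) - Y)) κ u κ' u' x z (Sum.inr m) b = 0 :=
  legDefect₁_inr ρ N _ κ u κ' u' x z m b

/-- NOT IN PRINT; OUR BOOKKEEPING.  **`D_{2,L₂} = L₂ (P₂ Y − Y) − (P₂ Y − Y)` ON FIELD COLUMNS**: bounded by `(2(d+1)N)²` times the double window sum of `∂₂^{slot}∂₂^{leg} Y`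
(second slot at `u′ + v′`, second leg at `z + v`). -/
theorem abs_defect_snd_leg₂_le (hN : 1 ≤ N) (hr : r ∈ box (d + 1) N) (Y : Tab d) (κ : Fin (d + 1)) (u : Fin (d + 1) → ℤ) (κ' : Fin (d + 1))
    (u' x z : Fin (d + 1) → ℤ) (a : Fib d) (β₀ : Fin (d + 1)) :
    |((fun κ u κ' u' => legCo₂BmAt (toSite r) N (((fun κ u => coProjBmAtK (toSite r) N (Y κ u)) - Y) κ u κ' u'))
        - ((fun κ u => coProjBmAtK (toSite r) N (Y κ u)) - Y)) κ u κ' u' x z a (Sum.inl β₀)|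
      ≤ (2 * ((d : ℝ) + 1) * N) ^ 2 * ∑ v ∈ cube (d + 1) N, ∑ v' ∈ cube (d + 1) N,
          |∑ β' : Fin (d + 1), ((∑ β : Fin (d + 1), (Y κ u β' (u' + v') x (z + v) a (Sum.inl β) - Y κ u β' (u' + v') x (z + v - unitVec β) a (Sum.inl β)))
            - (∑ β : Fin (d + 1), (Y κ u β' (u' + v' - unitVec β') x (z + v) a (Sum.inl β)
                - Y κ u β' (u' + v' - unitVec β') x (z + v - unitVec β) a (Sum.inl β))))| := by
  set Z : Tab d := (fun κ u => coProjBmAtK (toSite r) N (Y κ u)) - Y with hZ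
  have h1 := abs_legDefect₂_inl_le hN hr Z κ u κ' u' x z a β₀
  have h3 : ∀ v ∈ cube (d + 1) N, |∑ β : Fin (d + 1), (Z κ u κ' u' x (z + v) a (Sum.inl β) - Z κ u κ' u' x (z + v - unitVec β) a (Sum.inl β))|
      ≤ 2 * ((d : ℝ) + 1) * N * ∑ v' ∈ cube (d + 1) N,
          |∑ β' : Fin (d + 1), ((∑ β : Fin (d + 1), (Y κ u β' (u' + v') x (z + v) a (Sum.inl β) - Y κ u β' (u' + v') x (z + v - unitVec β) a (Sum.inl β)))
            - (∑ β : Fin (d + 1), (Y κ u β' (u' + v' - unitVec β') x (z + v) a (Sum.inl β)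
                - Y κ u β' (u' + v' - unitVec β') x (z + v - unitVec β) a (Sum.inl β))))| := by
    intro v _
    rw [hZ, legDiv₂_coProj_snd_sub_self]
    exact abs_coProjBmAt_sub_self_le hN hr _ κ' u'
  refine h1.trans ?_
  calc 2 * ((d : ℝ) + 1) * N * ∑ v ∈ cube (d + 1) N, |∑ β : Fin (d + 1), (Z κ u κ' u' x (z + v) a (Sum.inl β) - Z κ u κ' u' x (z + v - unitVec β) a (Sum.inl β))|
      ≤ 2 * ((d : ℝ) + 1) * N * ∑ v ∈ cube (d + 1) N, (2 * ((d : ℝ) + 1) * N * ∑ v' ∈ cube (d + 1) N,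
          |∑ β' : Fin (d + 1), ((∑ β : Fin (d + 1), (Y κ u β' (u' + v') x (z + v) a (Sum.inl β) - Y κ u β' (u' + v') x (z + v - unitVec β) a (Sum.inl β)))
            - (∑ β : Fin (d + 1), (Y κ u β' (u' + v' - unitVec β') x (z + v) a (Sum.inl β)
                - Y κ u β' (u' + v' - unitVec β') x (z + v - unitVec β) a (Sum.inl β))))|) :=
        mul_le_mul_of_nonneg_left (Finset.sum_le_sum h3) (two_mul_nonneg d N)
    _ = _ := by rw [← Finset.mul_sum]; ring

/-- [folklore] `D_{2,L₂}` vanishes on multiplier columns. -/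
theorem defect_snd_leg₂_inr (ρ : Fin (d + 1) → ℤ) (N : ℕ) (Y : Tab d) (κ : Fin (d + 1)) (u : Fin (d + 1) → ℤ) (κ' : Fin (d + 1)) (u' x z : Fin (d + 1) → ℤ)
    (a : Fib d) (m : Fin (d + 1)) :
    ((fun κ u κ' u' => legCo₂BmAt ρ N (((fun κ u => coProjBmAtK ρ N (Y κ u)) - Y) κ u κ' u'))
        - ((fun κ u => coProjBmAtK ρ N (Y κ u)) - Y)) κ u κ' u' x z a (Sum.inr m) = 0 :=
  legDefect₂_inr ρ N _ κ u κ' u' x z a m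

/-- NOT IN PRINT; OUR BOOKKEEPING.  **`D_{1,L₂} = L₂ (P₁ Y − Y) − (P₁ Y − Y)` ON FIELD COLUMNS**: bounded by `(2(d+1)N)²` times the double window sum of `∂₁^{slot}∂₂^{leg} Y`
(first slot at `u + v′`, second leg at `z + v`). -/
theorem abs_defect_fst_leg₂_le (hN : 1 ≤ N) (hr : r ∈ box (d + 1) N) (Y : Tab d) (κ : Fin (d + 1)) (u : Fin (d + 1) → ℤ) (κ' : Fin (d + 1))
    (u' x z : Fin (d + 1) → ℤ) (a : Fib d) (β₀ : Fin (d + 1)) :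
    |((fun κ u κ' u' => legCo₂BmAt (toSite r) N (((fun κ u κ' u' => coProjBmAtK (toSite r) N (fun κ₁ u₁ => Y κ₁ u₁ κ' u') κ u) - Y) κ u κ' u'))
        - ((fun κ u κ' u' => coProjBmAtK (toSite r) N (fun κ₁ u₁ => Y κ₁ u₁ κ' u') κ u) - Y)) κ u κ' u' x z a (Sum.inl β₀)|
      ≤ (2 * ((d : ℝ) + 1) * N) ^ 2 * ∑ v ∈ cube (d + 1) N, ∑ v' ∈ cube (d + 1) N,
          |∑ β' : Fin (d + 1), ((∑ β : Fin (d + 1), (Y β' (u + v') κ' u' x (z + v) a (Sum.inl β) - Y β' (u + v') κ' u' x (z + v - unitVec β) a (Sum.inl β)))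
            - (∑ β : Fin (d + 1), (Y β' (u + v' - unitVec β') κ' u' x (z + v) a (Sum.inl β)
                - Y β' (u + v' - unitVec β') κ' u' x (z + v - unitVec β) a (Sum.inl β))))| := by
  set W : Tab d := (fun κ u κ' u' => coProjBmAtK (toSite r) N (fun κ₁ u₁ => Y κ₁ u₁ κ' u') κ u) - Y with hW
  have h1 := abs_legDefect₂_inl_le hN hr W κ u κ' u' x z a β₀
  have h3 : ∀ v ∈ cube (d + 1) N, |∑ β : Fin (d + 1), (W κ u κ' u' x (z + v) a (Sum.inl β) - W κ u κ' u' x (z + v - unitVec β) a (Sum.inl β))|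
      ≤ 2 * ((d : ℝ) + 1) * N * ∑ v' ∈ cube (d + 1) N,
          |∑ β' : Fin (d + 1), ((∑ β : Fin (d + 1), (Y β' (u + v') κ' u' x (z + v) a (Sum.inl β) - Y β' (u + v') κ' u' x (z + v - unitVec β) a (Sum.inl β)))
            - (∑ β : Fin (d + 1), (Y β' (u + v' - unitVec β') κ' u' x (z + v) a (Sum.inl β)
                - Y β' (u + v' - unitVec β') κ' u' x (z + v - unitVec β) a (Sum.inl β))))| := by
    intro v _
    rw [hW, legDiv₂_coProj_fst_sub_self]
    exact abs_coProjBmAt_sub_self_le hN hr _ κ u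
  refine h1.trans ?_
  calc 2 * ((d : ℝ) + 1) * N * ∑ v ∈ cube (d + 1) N, |∑ β : Fin (d + 1), (W κ u κ' u' x (z + v) a (Sum.inl β) - W κ u κ' u' x (z + v - unitVec β) a (Sum.inl β))|
      ≤ 2 * ((d : ℝ) + 1) * N * ∑ v ∈ cube (d + 1) N, (2 * ((d : ℝ) + 1) * N * ∑ v' ∈ cube (d + 1) N,
          |∑ β' : Fin (d + 1), ((∑ β : Fin (d + 1), (Y β' (u + v') κ' u' x (z + v) a (Sum.inl β) - Y β' (u + v') κ' u' x (z + v - unitVec β) a (Sum.inl β)))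
            - (∑ β : Fin (d + 1), (Y β' (u + v' - unitVec β') κ' u' x (z + v) a (Sum.inl β)
                - Y β' (u + v' - unitVec β') κ' u' x (z + v - unitVec β) a (Sum.inl β))))|) :=
        mul_le_mul_of_nonneg_left (Finset.sum_le_sum h3) (two_mul_nonneg d N)
    _ = _ := by rw [← Finset.mul_sum]; ring

/-- [folklore] `D_{1,L₂}` vanishes on multiplier columns. -/
theorem defect_fst_leg₂_inr (ρ : Fin (d + 1) → ℤ) (N : ℕ) (Y : Tab d) (κ : Fin (d + 1)) (u : Fin (d + 1) → ℤ) (κ' : Fin (d + 1)) (u' x z : Fin (d + 1) → ℤ)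
    (a : Fib d) (m : Fin (d + 1)) :
    ((fun κ u κ' u' => legCo₂BmAt ρ N (((fun κ u κ' u' => coProjBmAtK ρ N (fun κ₁ u₁ => Y κ₁ u₁ κ' u') κ u) - Y) κ u κ' u'))
        - ((fun κ u κ' u' => coProjBmAtK ρ N (fun κ₁ u₁ => Y κ₁ u₁ κ' u') κ u) - Y)) κ u κ' u' x z a (Sum.inr m) = 0 :=
  legDefect₂_inr ρ N _ κ u κ' u' x z a m

/-- NOT IN PRINT; OUR BOOKKEEPING.  **`D_{L₁,L₂} = L₂ (L₁ Y − Y) − (L₁ Y − Y)` ON FIELD–FIELD ENTRIES**: bounded by `(2(d+1)N)²` times the double window sum of the two-leg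
divergence `∂₁∂₂ Y` (first leg at `x + v′`, second leg at `z + v`). -/
theorem abs_defect_leg₁_leg₂_le (hN : 1 ≤ N) (hr : r ∈ box (d + 1) N) (Y : Tab d) (κ : Fin (d + 1)) (u : Fin (d + 1) → ℤ) (κ' : Fin (d + 1))
    (u' x z : Fin (d + 1) → ℤ) (α β₀ : Fin (d + 1)) :
    |((fun κ u κ' u' => legCo₂BmAt (toSite r) N (((fun κ u κ' u' => legCo₁BmAt (toSite r) N (Y κ u κ' u')) - Y) κ u κ' u'))
        - ((fun κ u κ' u' => legCo₁BmAt (toSite r) N (Y κ u κ' u')) - Y)) κ u κ' u' x z (Sum.inl α) (Sum.inl β₀)|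
      ≤ (2 * ((d : ℝ) + 1) * N) ^ 2 * ∑ v ∈ cube (d + 1) N, ∑ v' ∈ cube (d + 1) N,
          |∑ α' : Fin (d + 1), ((∑ β : Fin (d + 1), (Y κ u κ' u' (x + v') (z + v) (Sum.inl α') (Sum.inl β) - Y κ u κ' u' (x + v') (z + v - unitVec β) (Sum.inl α') (Sum.inl β)))
            - (∑ β : Fin (d + 1), (Y κ u κ' u' (x + v' - unitVec α') (z + v) (Sum.inl α') (Sum.inl β)
                - Y κ u κ' u' (x + v' - unitVec α') (z + v - unitVec β) (Sum.inl α') (Sum.inl β))))| := by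
  set V : Tab d := (fun κ u κ' u' => legCo₁BmAt (toSite r) N (Y κ u κ' u')) - Y with hV
  have h1 := abs_legDefect₂_inl_le hN hr V κ u κ' u' x z (Sum.inl α) β₀
  have h3 : ∀ v ∈ cube (d + 1) N, |∑ β : Fin (d + 1), (V κ u κ' u' x (z + v) (Sum.inl α) (Sum.inl β) - V κ u κ' u' x (z + v - unitVec β) (Sum.inl α) (Sum.inl β))|
      ≤ 2 * ((d : ℝ) + 1) * N * ∑ v' ∈ cube (d + 1) N,
          |∑ α' : Fin (d + 1), ((∑ β : Fin (d + 1), (Y κ u κ' u' (x + v') (z + v) (Sum.inl α') (Sum.inl β) - Y κ u κ' u' (x + v') (z + v - unitVec β) (Sum.inl α') (Sum.inl β)))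
            - (∑ β : Fin (d + 1), (Y κ u κ' u' (x + v' - unitVec α') (z + v) (Sum.inl α') (Sum.inl β)
                - Y κ u κ' u' (x + v' - unitVec α') (z + v - unitVec β) (Sum.inl α') (Sum.inl β))))| := by
    intro v _
    rw [hV, legDiv₂_legCo₁_sub_self_inl]
    exact abs_coProjBmAt_sub_self_le hN hr _ α x
  refine h1.trans ?_
  calc 2 * ((d : ℝ) + 1) * N * ∑ v ∈ cube (d + 1) N,
        |∑ β : Fin (d + 1), (V κ u κ' u' x (z + v) (Sum.inl α) (Sum.inl β) - V κ u κ' u' x (z + v - unitVec β) (Sum.inl α) (Sum.inl β))|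
      ≤ 2 * ((d : ℝ) + 1) * N * ∑ v ∈ cube (d + 1) N, (2 * ((d : ℝ) + 1) * N * ∑ v' ∈ cube (d + 1) N,
          |∑ α' : Fin (d + 1), ((∑ β : Fin (d + 1), (Y κ u κ' u' (x + v') (z + v) (Sum.inl α') (Sum.inl β) - Y κ u κ' u' (x + v') (z + v - unitVec β) (Sum.inl α') (Sum.inl β)))
            - (∑ β : Fin (d + 1), (Y κ u κ' u' (x + v' - unitVec α') (z + v) (Sum.inl α') (Sum.inl β)
                - Y κ u κ' u' (x + v' - unitVec α') (z + v - unitVec β) (Sum.inl α') (Sum.inl β))))|) :=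
        mul_le_mul_of_nonneg_left (Finset.sum_le_sum h3) (two_mul_nonneg d N)
    _ = _ := by rw [← Finset.mul_sum]; ring

/-- [folklore] `D_{L₁,L₂}` vanishes on multiplier rows (the inner `L₁ Y − Y` already does). -/
theorem defect_leg₁_leg₂_inr_left (hN : 1 ≤ N) (hr : r ∈ box (d + 1) N) (Y : Tab d) (κ : Fin (d + 1)) (u : Fin (d + 1) → ℤ) (κ' : Fin (d + 1))
    (u' x z : Fin (d + 1) → ℤ) (m β₀ : Fin (d + 1)) :
    ((fun κ u κ' u' => legCo₂BmAt (toSite r) N (((fun κ u κ' u' => legCo₁BmAt (toSite r) N (Y κ u κ' u')) - Y) κ u κ' u'))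
        - ((fun κ u κ' u' => legCo₁BmAt (toSite r) N (Y κ u κ' u')) - Y)) κ u κ' u' x z (Sum.inr m) (Sum.inl β₀) = 0 := by
  set V : Tab d := (fun κ u κ' u' => legCo₁BmAt (toSite r) N (Y κ u κ' u')) - Y with hV
  have h1 := abs_legDefect₂_inl_le hN hr V κ u κ' u' x z (Sum.inr m) β₀
  have h0 : ∀ v ∈ cube (d + 1) N, |∑ β : Fin (d + 1), (V κ u κ' u' x (z + v) (Sum.inr m) (Sum.inl β) - V κ u κ' u' x (z + v - unitVec β) (Sum.inr m) (Sum.inl β))| = 0 := by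
    intro v _
    rw [hV, legDiv₂_legCo₁_sub_self_inr, abs_zero]
  rw [Finset.sum_congr rfl h0, Finset.sum_const_zero, mul_zero] at h1
  exact abs_eq_zero.1 (le_antisymm h1 (abs_nonneg _))

/-- [folklore] `D_{L₁,L₂}` vanishes on multiplier columns. -/
theorem defect_leg₁_leg₂_inr_right (ρ : Fin (d + 1) → ℤ) (N : ℕ) (Y : Tab d) (κ : Fin (d + 1)) (u : Fin (d + 1) → ℤ) (κ' : Fin (d + 1))
    (u' x z : Fin (d + 1) → ℤ) (a : Fib d) (m : Fin (d + 1)) :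
    ((fun κ u κ' u' => legCo₂BmAt ρ N (((fun κ u κ' u' => legCo₁BmAt ρ N (Y κ u κ' u')) - Y) κ u κ' u'))
        - ((fun κ u κ' u' => legCo₁BmAt ρ N (Y κ u κ' u')) - Y)) κ u κ' u' x z a (Sum.inr m) = 0 :=
  legDefect₂_inr ρ N _ κ u κ' u' x z a m

end Nest

end Summit.QuantumFields.BalabanUV.Beta.GAN24.SlotDefectWindowLegs

end
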